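import Literature.Analysis.FluidPDE.JiaSverak2013Lemma8Holds
import Literature.Analysis.FluidPDE.LocalEnergyExtensionHolds
import Literature.Analysis.FluidPDE.NSLerayHopfSereginMildLiveLeaves
import HarnessLib

/-!
# Discharges of named facts of `NSSereginMildFacts.lean`

`Literature/Analysis/FluidPDE/NSSereginMildFactsHolds.lean` — proofs-only sibling of
`NSSereginMildFacts.lean` (no definitions, no named facts). Each theorem below closes a named
fact `X : Prop` of that file as `X_holds : X` by composing an ACCEPTED reduction theorem of
the tree with the ACCEPTED unconditional `_holds` discharges of all of its hypotheses; nothing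
is re-proved and no statement is changed. Recorded by the librarian sweep g25 (2026-08-16,
pass 5c: facts dischargeable in one line from the tree's own lemmas), so that the facts
census, `#h21_route_deps` and the cone guardrail see these facts as theorems.

Discharged here:

* `lemarieRieusset_prop_15_1_holds` := `lemarieRieusset_prop_15_1_of_extension_of_lemma_8`
  `localEnergySolution_extension_of_memE2_holds` `jia_sverak_2013_lemma_8_holds`
  (`NSLerayHopfSereginMildLiveLeaves.lean`).

## References

* [LemarieRieusset2016] — see `lean/references.bib` and the docstring of the fact in `NSSereginMildFacts.lean`.
-/

namespace Literature.Analysis.FluidPDE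

/-- **Discharge of the named fact `lemarieRieusset_prop_15_1`** (`NSSereginMildFacts.lean`): Local
Leray solutions with an initial value in `L³` (Lemarié-Rieusset 2016, Prop. 15.1, PDF p. 559
of doi:10.1201/b19556, proof pp. 560–564 (after Calderón 1990 and Jia–Šverák 2014), in the
form used on pp. 570–571). Printed: "Let `M > 0`. … — obtained as
`lemarieRieusset_prop_15_1_of_extension_of_lemma_8` applied to the tree's unconditional
discharges `localEnergySolution_extension_of_memE2_holds`, `jia_sverak_2013_lemma_8_holds` of
its hypotheses (reduction in `NSLerayHopfSereginMildLiveLeaves.lean`).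
[cite: LemarieRieusset2016, Prop. 15.1 (p. 559; proof pp. 560–564; as used pp. 570–571)] -/
theorem lemarieRieusset_prop_15_1_holds :
    lemarieRieusset_prop_15_1 :=
  lemarieRieusset_prop_15_1_of_extension_of_lemma_8
    localEnergySolution_extension_of_memE2_holds
    jia_sverak_2013_lemma_8_holds

end Literature.Analysis.FluidPDE
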